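import Summits.QuantumFields.YangMills.Theses.BalabanLadder
import Summits.QuantumFields.YangMills.Theorems.BalabanLadderUVRecord13

/-!
# BalabanLadder ∕ UV — the Record-13 station AT THE SPINE LEAF BY NAME: `UVAtParams13 2 → BalabanLadder.UV`, `UVAtRecord13C 2 → BalabanLadder.UV`, and
# Track A's rev-16 four item TEXTS ⟹ `BalabanLadder.UV` by name

OS-ASSEMBLY BOOKKEEPING (cell `ym-fleet`, seat `ym-osasm-p1`, director-ym R136 (iii); `--supports stmt-QuantumFields-19351`).  Three one-line theorems; 0 `sorry`,
0 `def`, standard axioms; COUNT-NEUTRAL.  This is the ONLY module of the Record-13 station that imports the spine route file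
`Summits.QuantumFields.YangMills.Theses.BalabanLadder` (the station itself, `…UVRecord13Defs` p489475 ∕ `…UVRecord13` p489689, is route-independent); it does NOT
import Track A's route file — the four rev-16 item texts (`route-QuantumFields-BalabanUVNodes` rev 16∕17, items 19909 `Record13Inhabited` ∕ 19910
`StabilityBAtRecordR13e` ∕ 19911 `EndpointGivenBR13` ∕ 19912 `SpineGivenEndpointR13`) enter through `uvAtParams13_of_chain`'s INLINE binders, which those items
feed by unfolding.  Hence: immune to Track A's route edits; sensitive only to the TEXT of `BalabanLadder.UV`, which the owner's RULING R27 (2026-08-27T03:08Z) keeps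
at today's Stage-0 form through R85 (under a later θ re-text, reopener R27 (3), `uv_of_uvAtParams13_two` becomes the identity and this file shrinks).

* `uv_of_uvAtParams13_two` — the θ-keyed Stage-13 package at `N = 2` gives the spine leaf BY NAME (`stage0_of_uvAtParams13`, definitional unfolding of `UV`).
* `uv_of_uvAtRecord13C_two` — the same from the (D, w)-keyed package (`stage0_of_uvAtRecord13C`).
* `uv_of_record13Chain_two` — Track A's rev-16 four TEXTS at `N = 2` ⟹ `BalabanLadder.UV` BY NAME: the ₁₃ twin of the ₁₂-keyed by-name tethers the
  ASSEMBLY-CENSUS add-on (c) grades (`Theorems.UVOtherGroups.uv_of_theta15Chain_two` p468340 over Record 12); as TERMS it is `BalabanUVNodes.closes` rev 16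
  (desk junction J3, `rfl`, evidence #30 on stmt-QuantumFields-19351).

HONEST FRAMING.  Modus-ponens glue for HYPOTHESES of a conditional chain (Track A's four ‴ items are OPEN; 0∕6 spine legs discharged); one finite four-torus
programme per family at fixed ε; NOT infinite volume, NOT OS on ℝ⁴, NOT a mass gap, NOT Clay.
-/

set_option autoImplicit false

namespace Summit.QuantumFields.YangMills.Cruxes.UV.Record13

open Literature.MathematicalPhysics.QuantumFieldTheory.Balaban1983to89
open Literature.MathematicalPhysics.QuantumFieldTheory.Balaban1983to89.T4Continuum

/-- **THE θ-KEYED STAGE-13 PACKAGE AT `N = 2` GIVES THE SPINE LEAF BY NAME**: `UVAtParams13 2 → Summit.QuantumFields.YangMills.Theses.BalabanLadder.UV`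
(the Stage-0 projection `stage0_of_uvAtParams13`; `UV`'s text of record IS that Stage-0 conjunction, owner RULING R27). -/
theorem uv_of_uvAtParams13_two (h : UVAtParams13 2) : Summit.QuantumFields.YangMills.Theses.BalabanLadder.UV :=
  fun F => stage0_of_uvAtParams13 h F

/-- **THE (D, w)-KEYED STAGE-13 PACKAGE AT `N = 2` GIVES THE SPINE LEAF BY NAME** (`stage0_of_uvAtRecord13C`). -/
theorem uv_of_uvAtRecord13C_two (h : UVAtRecord13C 2) : Summit.QuantumFields.YangMills.Theses.BalabanLadder.UV :=
  fun F => stage0_of_uvAtRecord13C h F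

/-- **TRACK A's REV-16 FOUR ITEM TEXTS AT `N = 2` ⟹ THE SPINE LEAF BY NAME**: inhabitation of the admissible Stage-13 unity tuples with non-degenerate
slots (text of `Record13Inhabited`, 19909) · (B) + window at some such tuple (`StabilityBAtRecordR13e`, 19910) · END given (B) + window (`EndpointGivenBR13`,
19911) · hybrid-NE7 spine given (B) + END (`SpineGivenEndpointR13`, 19912) ⟹ `BalabanLadder.UV` — through the station (`uvAtParams13_of_chain`, then the
projection).  The items feed these binders by unfolding; as terms this is the rev-16 `BalabanUVNodes.closes`. -/
theorem uv_of_record13Chain_two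
    (h0 : ∀ F : T4Family, ∃ θ : Node00.Stage13Params F 2, θ.Provisos₁₃ F 2 ∧ (θ.ZtUnity F 2 ∧ θ.SlotsNondegenerate₁₃ F 2) ∧ θ.Admissible F 2)
    (h1 : ∀ F : T4Family, (∃ θ : Node00.Stage13Params F 2, θ.Provisos₁₃ F 2 ∧ (θ.ZtUnity F 2 ∧ θ.SlotsNondegenerate₁₃ F 2) ∧ θ.Admissible F 2) →
      ∃ (θ : Node00.Stage13Params F 2) (h : θ.Provisos₁₃ F 2), (θ.ZtUnity F 2 ∧ θ.SlotsNondegenerate₁₃ F 2) ∧ θ.Admissible F 2 ∧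
        B16.EndStatementBPrinted (Node00.datumOfRecord₁₃ F 2 θ h).C ∧ ∃ γ₁ : ℝ, 0 < γ₁ ∧ ∀ γ : ℝ, 0 < γ → γ ≤ γ₁ →
          ∃ P : B12.RunParams, 1 ≤ P.K ∧ ((Node00.datumOfRecord₁₃ F 2 θ h).C P).flow.InInterval γ P.K)
    (h2 : ∀ (F : T4Family) (θ : Node00.Stage13Params F 2) (h : θ.Provisos₁₃ F 2), (θ.ZtUnity F 2 ∧ θ.SlotsNondegenerate₁₃ F 2) → θ.Admissible F 2 →
      B16.EndStatementBPrinted (Node00.datumOfRecord₁₃ F 2 θ h).C → (∃ γ₁ : ℝ, 0 < γ₁ ∧ ∀ γ : ℝ, 0 < γ → γ ≤ γ₁ →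
        ∃ P : B12.RunParams, 1 ≤ P.K ∧ ((Node00.datumOfRecord₁₃ F 2 θ h).C P).flow.InInterval γ P.K) →
      DagBinding.EndpointExistence (Node00.datumOfRecord₁₃ F 2 θ h).C.toB12)
    (h3 : ∀ (F : T4Family) (θ : Node00.Stage13Params F 2) (h : θ.Provisos₁₃ F 2), (θ.ZtUnity F 2 ∧ θ.SlotsNondegenerate₁₃ F 2) → θ.Admissible F 2 →
      B16.EndStatementBPrinted (Node00.datumOfRecord₁₃ F 2 θ h).C → DagBinding.EndpointExistence (Node00.datumOfRecord₁₃ F 2 θ h).C.toB12 →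
      T4ApexHybrid.HybridNE7Under (Node00.datumOfRecord₁₃ F 2 θ h) (DagBinding.EndpointExistence (Node00.datumOfRecord₁₃ F 2 θ h).C.toB12)) :
    Summit.QuantumFields.YangMills.Theses.BalabanLadder.UV :=
  uv_of_uvAtParams13_two (uvAtParams13_of_chain h0 h1 h2 h3)

end Summit.QuantumFields.YangMills.Cruxes.UV.Record13
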